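import Mathlib.RingTheory.DiscreteValuationRing.Basic
import Mathlib.Algebra.GroupWithZero.NonZeroDivisors
import Literature.IUT.HodgeArakelov.KummerPrimeStrips

/-!
# [IUTchII] Definition 4.9 (ii): the presentation `O^⊥/μ_{2l} ⥲ O^▷/O^×` — proofs (companion to
# `KummerPrimeStrips.lean`)

S. Mochizuki, *Inter-universal Teichmüller theory II*, §4, Definition 4.9 (ii) (kurims Dec-2020
manuscript p. 155) [cite: Mochizuki2012, Def 4.9 (ii) p.155]; the "split Frobenioid" content is
[IUTchI] Example 3.2 (v) / Example 3.3 (split pre-Frobenioid structure at `v ∈ V^bad`, `v ∈ V^good`).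
Claim key DISPUTED (D-0012): nothing in this file asserts a disputed claim or takes a side on
[IUTchIII] Cor 3.12; what is proved is elementary monoid algebra plus one classical fact about
discrete valuation rings. PROOF-ONLY companion (abc-iut cell, layer L6, node **IUTchII:Def4.9(ii)**;
WAVE-3 seat abc-iut-L6-d7): no new definitions; imports abc-iut-L6-t2's `KummerPrimeStrips` (p405008).

**What is discharged.** `KummerPrimeStrips.lean` records the bracket of Def 4.9 (ii) p. 155 — "`O^▶(‡A)
:= O^⊥(‡A)/μ_{2l}(‡A)` [so we have a natural isomorphism `O^▷(‡A)/O^×(‡A) ⥲ O^▶(‡A)`]" — as the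
Prop-valued statement `OPerpPresentsAssociates O twoL splitting` (the field `presents` of
`NonarchTriMuDatum`), "recorded on the splitting data; not asserted". Here:

* `OPerpPresentsAssociates_of_bijective`: it HOLDS, for every `twoL`, as soon as the splitting
  submonoid maps bijectively onto `O^▷/O^× = Associates O` — which is exactly what "split
  [pre-]Frobenioid" means ([IUTchI] Ex 3.2 (v): the splitting is a section of `O^▷ ↠ O^▷/O^×`); no
  cancellativity of `O` is needed.
* `OPerpPresentsAssociates_one_iff`: at a good nonarchimedean place (`twoL = 1`, Def 4.9 (iv) p. 156,
  "`O^⊥(‡A) :=` the image of the splitting") the statement is EQUIVALENT to that bijectivity; for general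
  `twoL` it implies surjectivity (`splitting_mk_surjective_of_presents`).
* `isUnit_iff_of_presents`: under the statement, the invertible elements of `O^⊥` are exactly
  `μ_{2l}` — the kernel-visible form of "`O^▶ = O^⊥/μ_{2l}`".
* NON-VACUITY / MODEL (`OPerpPresentsAssociates_nonZeroDivisors_powers`): for a discrete valuation ring
  `R` (e.g. `𝒪_{K_v}`) with uniformizer `ϖ`, the monoid `O := R ∖ {0}` of non-zero-divisors with the
  splitting `ϖ^ℕ` satisfies `OPerpPresentsAssociates O twoL (powers ϖ)` for EVERY `twoL` — the honest
  split monoid "`O^× · q^ℕ`" of [IUTchI] Ex 3.2 (v) / Ex 3.3 (classical: every non-zero `x` is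
  `u · ϖ^n` with `n` unique, Mathlib `IsDiscreteValuationRing.eq_unit_mul_pow_irreducible`,
  `unit_mul_pow_congr_pow`).
-/

namespace Literature.IUT.HodgeArakelov

open scoped nonZeroDivisors

universe u

/-! ### 1. Membership in `O^⊥` and the projection to `O^▶` -/

section Bridge

variable {O : Type u} [CommMonoid O]

/-- **IUTchII:Def4.9(ii)** (kurims p.155) Elements of `O^⊥(‡A)` — "the submonoid generated by `μ_{2l}(‡A)`
and the image of the splitting" — are exactly the products `ζ · s`, `ζ ∈ μ_{2l}`, `s` in the splitting
image (the monoid is commutative). [cite: Mochizuki2012, Def 4.9 (ii) p.155] -/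
theorem mem_OPerp_iff (twoL : ℕ) (S : Submonoid O) (x : O) :
    x ∈ OPerp O twoL S ↔ ∃ ζ : Oˣ, ζ ∈ rootsOfUnity twoL O ∧ ∃ s ∈ S, (ζ : O) * s = x := by
  unfold OPerp
  rw [Submonoid.mem_sup]
  constructor
  · rintro ⟨y, hy, z, hz, rfl⟩
    obtain ⟨ζ, hζ, rfl⟩ := Submonoid.mem_map.mp hy
    exact ⟨ζ, hζ, z, hz, rfl⟩
  · rintro ⟨ζ, hζ, s, hs, rfl⟩
    exact ⟨(ζ : O), Submonoid.mem_map.mpr ⟨ζ, hζ, rfl⟩, s, hs, rfl⟩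

/-- **IUTchII:Def4.9(ii)** (kurims p.155) The projection `O^▷ ↠ O^▶ = O^▷/O^×` sends `x` to its class of
associates. [cite: Mochizuki2012, Def 4.9 (ii) p.155] -/
theorem toOTri_apply (x : O) : toOTri O x = Associates.mk x := rfl

/-- **IUTchII:Def4.9(ii)** (kurims p.155) Two elements of `O^▷` have the same image in `O^▶ = O^▷/O^×` iff
they are associated (differ by a unit). [cite: Mochizuki2012, Def 4.9 (ii) p.155] -/
theorem toOTri_eq_iff (x y : O) : toOTri O x = toOTri O y ↔ Associated x y :=
  Associates.mk_eq_mk_iff_associated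

/-! ### 2. The presentation holds for a split monoid -/

/-- **IUTchII:Def4.9(ii)** (kurims p.155; content of "split Frobenioid", [IUTchI] Ex 3.2 (v)) If the
splitting submonoid `S ⊆ O^▷` maps BIJECTIVELY onto `O^▷/O^×` (i.e. it is the image of a section of
`O^▷ ↠ O^▷/O^×`), then `O^⊥ = μ_{2l} · S` presents `O^▶`: `O^⊥ ↠ O^▷/O^×` is surjective and identifies
exactly the `μ_{2l}`-multiples — for EVERY `twoL`. [cite: Mochizuki2012, Def 4.9 (ii) p.155] -/
theorem OPerpPresentsAssociates_of_bijective (twoL : ℕ) (S : Submonoid O)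
    (hS : Function.Bijective fun s : S => Associates.mk (s : O)) :
    OPerpPresentsAssociates O twoL S := by
  refine ⟨fun a => ?_, fun x hx y hy => ?_⟩
  · obtain ⟨s, hs⟩ := hS.2 a
    exact ⟨s, splitting_le_OPerp O twoL S s.2, hs⟩
  · obtain ⟨ζ, hζ, s, hs, rfl⟩ := (mem_OPerp_iff twoL S x).mp hx
    obtain ⟨ζ', hζ', s', hs', rfl⟩ := (mem_OPerp_iff twoL S y).mp hy
    constructor
    · intro h
      have h' : Associated s s' := by
        have h₁ := (toOTri_eq_iff _ _).mp h
        rwa [associated_unit_mul_left_iff, associated_unit_mul_right_iff] at h₁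
      have hss' : s = s' :=
        congrArg Subtype.val
          (@hS.1 ⟨s, hs⟩ ⟨s', hs'⟩ (Associates.mk_eq_mk_iff_associated.mpr h'))
      subst hss'
      refine ⟨ζ * ζ'⁻¹, Subgroup.mul_mem _ hζ (Subgroup.inv_mem _ hζ'), ?_⟩
      rw [Units.val_mul, mul_assoc, Units.inv_mul_cancel_left]
    · rintro ⟨ζ'', -, h⟩
      rw [h, toOTri_eq_iff]
      exact associated_unit_mul_left_iff.mpr (Associated.refl _)

/-- **IUTchII:Def4.9(ii)** (kurims p.155) Conversely, the presentation statement always yields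
SURJECTIVITY of the splitting onto `O^▷/O^×` (every class has a representative `ζ · s`, which is
associated to `s`). [cite: Mochizuki2012, Def 4.9 (ii) p.155] -/
theorem splitting_mk_surjective_of_presents {twoL : ℕ} {S : Submonoid O}
    (h : OPerpPresentsAssociates O twoL S) :
    Function.Surjective fun s : S => Associates.mk (s : O) := by
  intro a
  obtain ⟨x, hx, rfl⟩ := h.1 a
  obtain ⟨ζ, -, s, hs, rfl⟩ := (mem_OPerp_iff twoL S x).mp hx
  refine ⟨⟨s, hs⟩, ?_⟩
  show Associates.mk s = toOTri O ((ζ : O) * s)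
  rw [toOTri_apply, Associates.mk_eq_mk_iff_associated]
  exact associated_unit_mul_right_iff.mpr (Associated.refl _)

/-- **IUTchII:Def4.9(ii)**/(iv) (kurims p.156: at `w ∈ V^good ∩ V^non`, "`O^⊥(‡A) :=` the image of the
splitting", no roots of unity adjoined, `twoL = 1`) — then the presentation statement also yields
INJECTIVITY of the splitting into `O^▷/O^×`. [cite: Mochizuki2012, Def 4.9 (iv) p.156] -/
theorem splitting_mk_injective_of_presents_one {S : Submonoid O}
    (h : OPerpPresentsAssociates O 1 S) :
    Function.Injective fun s : S => Associates.mk (s : O) := by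
  rintro ⟨s, hs⟩ ⟨s', hs'⟩ hss'
  have hx : s ∈ OPerp O 1 S := splitting_le_OPerp O 1 S hs
  have hy : s' ∈ OPerp O 1 S := splitting_le_OPerp O 1 S hs'
  have e : toOTri O s = toOTri O s' := hss'
  obtain ⟨ζ, hζ, hζs⟩ := (h.2 s hx s' hy).mp e
  have hζ1 : ζ = 1 := by simpa [mem_rootsOfUnity] using hζ
  subst hζ1
  exact Subtype.ext (by simpa using hζs)

/-- **IUTchII:Def4.9(ii)**/(iv) (kurims pp.155–156) At a good nonarchimedean place (`twoL = 1`) the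
recorded statement "`O^⊥ ⥲ O^▷/O^×`" is EQUIVALENT to: the splitting is a section of `O^▷ ↠ O^▷/O^×`
(split Frobenioid, [IUTchI] Ex 3.3). [cite: Mochizuki2012, Def 4.9 (iv) p.156] -/
theorem OPerpPresentsAssociates_one_iff (S : Submonoid O) :
    OPerpPresentsAssociates O 1 S ↔ Function.Bijective fun s : S => Associates.mk (s : O) :=
  ⟨fun h => ⟨splitting_mk_injective_of_presents_one h, splitting_mk_surjective_of_presents h⟩,
    OPerpPresentsAssociates_of_bijective 1 S⟩

/-- **IUTchII:Def4.9(ii)** (kurims p.155) Kernel-visible form of "`O^▶(‡A) := O^⊥(‡A)/μ_{2l}(‡A)`" being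
the quotient by the UNITS: under the presentation statement, an element of `O^⊥` is invertible in
`O^▷` iff it lies in `μ_{2l}`. [cite: Mochizuki2012, Def 4.9 (ii) p.155] -/
theorem isUnit_iff_of_presents {twoL : ℕ} {S : Submonoid O} (h : OPerpPresentsAssociates O twoL S)
    {x : O} (hx : x ∈ OPerp O twoL S) :
    IsUnit x ↔ ∃ ζ : Oˣ, ζ ∈ rootsOfUnity twoL O ∧ (ζ : O) = x := by
  constructor
  · intro hu
    have e : toOTri O x = toOTri O 1 := by
      rw [toOTri_eq_iff]
      exact associated_one_iff_isUnit.mpr hu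
    obtain ⟨ζ, hζ, hx1⟩ := (h.2 x hx 1 (one_mem _)).mp e
    exact ⟨ζ, hζ, by simpa using hx1.symm⟩
  · rintro ⟨ζ, -, rfl⟩
    exact Units.isUnit ζ

end Bridge

/-! ### 3. Non-vacuity: the split monoid `𝒪^▷ = 𝒪^× · ϖ^ℕ` of a discrete valuation ring -/

section DVRModel

variable {R : Type u} [CommRing R] [IsDomain R] [IsDiscreteValuationRing R]

/-- **IUTchII:Def4.9(ii)** MODEL (classical; [IUTchI] Ex 3.2 (v) / Ex 3.3: the split pre-Frobenioid
structure of `𝒪^▷_{K_v} = 𝒪^×_{K_v} · ϖ^ℕ`). For a discrete valuation ring `R` with uniformizer `ϖ`,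
the powers of `ϖ` inside the monoid `R⁰ = R ∖ {0}` map BIJECTIVELY onto `R⁰/R^×`: every non-zero `x` is
`u · ϖ^n` with `u` a unit and `n` uniquely determined. [cite: Mochizuki2012, Def 4.9 (ii) p.155] -/
theorem powers_mk_bijective_of_irreducible {ϖ : R} (hϖ : Irreducible ϖ) :
    Function.Bijective fun s : Submonoid.powers
        (⟨ϖ, mem_nonZeroDivisors_of_ne_zero hϖ.ne_zero⟩ : R⁰) => Associates.mk (s : R⁰) := by
  set ϖ' : R⁰ := ⟨ϖ, mem_nonZeroDivisors_of_ne_zero hϖ.ne_zero⟩ with hϖ'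
  constructor
  · rintro ⟨s, hs⟩ ⟨t, ht⟩ hst
    obtain ⟨m, rfl⟩ := (Submonoid.mem_powers_iff _ _).mp hs
    obtain ⟨n, rfl⟩ := (Submonoid.mem_powers_iff _ _).mp ht
    obtain ⟨c, hc⟩ := Associates.mk_eq_mk_iff_associated.mp hst
    -- `hc : ϖ' ^ m * ↑c = ϖ' ^ n` in `R⁰`; read it in `R`
    have hcR : ((Units.map (R⁰).subtype c : Rˣ) : R) * ϖ ^ m = ((1 : Rˣ) : R) * ϖ ^ n := by
      have := congrArg (Subtype.val : R⁰ → R) hc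
      simp only [Submonoid.coe_mul, SubmonoidClass.coe_pow] at this
      rw [Units.coe_map, Submonoid.subtype_apply, Units.val_one, one_mul, mul_comm]
      exact this
    have hmn : m = n := IsDiscreteValuationRing.unit_mul_pow_congr_pow hϖ hϖ _ _ m n hcR
    subst hmn
    rfl
  · intro a
    obtain ⟨x, rfl⟩ := Associates.mk_surjective a
    have hx0 : (x : R) ≠ 0 := nonZeroDivisors.ne_zero x.2
    obtain ⟨n, u, hxu⟩ := IsDiscreteValuationRing.eq_unit_mul_pow_irreducible hx0 hϖ
    refine ⟨⟨ϖ' ^ n, (Submonoid.mem_powers_iff _ _).mpr ⟨n, rfl⟩⟩, ?_⟩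
    show Associates.mk (ϖ' ^ n) = Associates.mk x
    rw [Associates.mk_eq_mk_iff_associated]
    -- the unit `u`, viewed in the monoid `R⁰`
    refine ⟨⟨⟨(u : R), u.isUnit.mem_nonZeroDivisors⟩, ⟨((u⁻¹ : Rˣ) : R), u⁻¹.isUnit.mem_nonZeroDivisors⟩,
      Subtype.ext u.mul_inv, Subtype.ext u.inv_mul⟩, ?_⟩
    apply Subtype.ext
    simp only [Submonoid.coe_mul, SubmonoidClass.coe_pow, hϖ']
    rw [hxu, mul_comm]

/-- **IUTchII:Def4.9(ii)** NON-VACUITY of the `presents` slot of `NonarchTriMuDatum` (kurims p.155; Def 4.9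
(iii)/(iv)): for a discrete valuation ring `R` with uniformizer `ϖ`, the monoid `R⁰ = R ∖ {0}` with
splitting `ϖ^ℕ` satisfies `OPerpPresentsAssociates R⁰ twoL (powers ϖ)` for EVERY `twoL` (`2l` at bad
places, `1` at good ones): `μ_{twoL}(R) · ϖ^ℕ ↠ R⁰/R^×` identifies exactly the `μ_{twoL}`-multiples.
Classical ([IUTchI] Ex 3.2 (v) / 3.3 split monoid `𝒪^× · q^ℕ`). [cite: Mochizuki2012, Def 4.9 (ii) p.155] -/
theorem OPerpPresentsAssociates_nonZeroDivisors_powers {ϖ : R} (hϖ : Irreducible ϖ) (twoL : ℕ) :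
    OPerpPresentsAssociates R⁰ twoL
      (Submonoid.powers (⟨ϖ, mem_nonZeroDivisors_of_ne_zero hϖ.ne_zero⟩ : R⁰)) :=
  OPerpPresentsAssociates_of_bijective twoL _ (powers_mk_bijective_of_irreducible hϖ)

/-- **IUTchII:Def4.9(ii)** The slot is satisfiable for every `twoL`: SOME commutative monoid with SOME
splitting satisfies `OPerpPresentsAssociates` (witness: `ℤ_{(p)}`-type DVRs exist — we use any DVR `R`
supplied by the caller; see `OPerpPresentsAssociates_nonZeroDivisors_powers`). Stated for a given DVR to
avoid choosing one. [cite: Mochizuki2012, Def 4.9 (ii) p.155] -/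
theorem OPerpPresentsAssociates_satisfiable (twoL : ℕ) :
    ∃ S : Submonoid R⁰, OPerpPresentsAssociates R⁰ twoL S := by
  obtain ⟨ϖ, hϖ⟩ := IsDiscreteValuationRing.exists_irreducible R
  exact ⟨_, OPerpPresentsAssociates_nonZeroDivisors_powers hϖ twoL⟩

end DVRModel

end Literature.IUT.HodgeArakelov
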